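import Summits.ABC.IUTFork.Cor312LogKummerGlobal
import Summits.ABC.IUTFork.Cor312IndVolumeInvariance
import Summits.ABC.IUTFork.Cor312IndVolumeReal
import Summits.ABC.IUTFork.Cor312ThetaAdmReal
import HarnessLib

/-!
# [IUTchIII] Cor. 3.12 — TEAM B CAPSTONE, GLOBAL FORM: the printed Statement from instance data and the
# NAMED global (xi-g) comparison

Record-only file (D-0012) of the abc-iut cell (Cor. 3.12 strategy TEAM B «estimate / log-Kummer» of
HUMAN RULING D-0067 (3); seat abc-iut-c312-12 = B2, composing per abc-iut-c312-11's 00:33Z GO); TAKES NO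
SIDE. The PRINT-LEVEL sibling of the per-packet capstone `teamB_capstone_of_latticeRealisations`
(p413800, labelled G1′ STRONGER-THAN-PRINT per the quantifier analysis of skel XXIV `ForkLocalGlobal`,
adopted as spec v2 (G1′)): the printed (xi-g) sentence compares GLOBAL procession-normalized numbers, and
the NAMED global Prop of that comparison is abc-iut-c312-11's `Cor312Vol.GlobalVolumeTransport`
(`Cor312LogKummerGlobal`, p414039; gap row G-c312-11-1-SUPPLEMENT, locator kurims p. 184 l. 30–34).

`teamB_capstone_global_of_latticeRealisations` — **the printed `Statement` of Cor. 3.12 follows in the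
kernel from**:

1. single-Haar-container INSTANCE DATA, exactly as in p413800 (container readings of the mono-analytic
   log-volume/admissibility; the (Ind1)/(Ind2) generator families and the Kummer isomorphisms realised by
   homeomorphisms mapping SOME integral structure onto itself, Dupuy–Hilado §4.7/§4.9, [IUTchIII]
   Prop. 3.1 (ii); the Kummer images of the Θ-pilot object realised from ONE reference region of positive
   finite volume, Prop. 3.9 (i); monotonicity; (Ind3)-region data; `ThetaFinite`) — from which
   `BridgeHyps` (via c312-11's `bridgeHyps_of_generators`, p411632, fed by B2's criterion p411395) and
   `ThetaRegionsAdm` (B2's criterion p413177) are DERIVED;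
2. **`GlobalVolumeTransport P`** — the ONE residual input, at the PRINT'S OWN quantifier level (a global
   `≤` between `−|log(q)|` and a procession-normalized sum of single-Kummer-image log-volumes). NOTHING
   here asserts it; whether it follows from the frozen FACT LIST is the adjudication.

No typed Theorem 3.11 premise is consumed: the global route runs at the coric level (layer 1,
`Cor312LogKummerGlobal`); the per-packet ⇒ global bridge and the independence/hierarchy certificates
(`globalVolumeTransport_of_volumeTransport`, `GapWitness.thm311_bridgeHyps_adm_not_imp_globalVolumeTransport`,
`Cor312VolumeTransportHierarchy`) are landed in p414039/p413778/p413793 and are NOT re-proved. A uniform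
variant at a single lattice position (`GlobalVolumeTransportAt m₀`, the print's gluing position `m₀ = 0`)
is included. Sources: [IUTchIII] pp. 173–174, p. 181 (Step (x)), p. 184 l. 30–34 ((xi-g));
Dupuy–Hilado §4.7–4.9. [claim: Mochizuki2012, status: disputed] [cite: DupuyHilado2025, §4.9]
Deliberately NOT here: any assertion of clause 2, the weighted/frames containers (c312-6 g3), the
instance data itself, any judgement on Cor. 3.12.
-/

noncomputable section

open Set
open Literature.IUT.LogVolume

namespace Summit.ABC

namespace IUTFork

namespace Cor312Vol

open Thm311 Cor312 Literature.IUT.LogThetaLattice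

variable {T : ThetaIndex} {S : Situation T} (P : Cor312.Setting S)
variable {W : T.Label → T.VQ → Type*} [∀ j vQ, AddCommGroup (W j vQ)]
  [∀ j vQ, TopologicalSpace (W j vQ)] [∀ j vQ, IsTopologicalAddGroup (W j vQ)]
  [∀ j vQ, MeasurableSpace (W j vQ)] [∀ j vQ, BorelSpace (W j vQ)]
  (Λ : ∀ j vQ, IntegralStructure (W j vQ)) (d : T.Label → T.VQ → ℕ)
  (e : ∀ (j : T.Label) (vQ : T.VQ), S.L.Packet j vQ → W j vQ)
  (ψ : ℤ → ∀ (j : T.Label) (vQ : T.VQ), W j vQ ≃ₜ+ W j vQ)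
  (R : ∀ (j : T.Label) (vQ : T.VQ), Set (S.L.Packet j vQ))

/-- **TEAM B CAPSTONE, GLOBAL (print-level) FORM** — the printed `Statement` of [IUTchIII] Cor. 3.12
from single-Haar-container instance data (as in p413800) and the ONE residual input at the print's own
quantifier level: the NAMED global (xi-g) comparison `GlobalVolumeTransport P` (gap row
G-c312-11-1-SUPPLEMENT, kurims p. 184 l. 30–34). `BridgeHyps` and `ThetaRegionsAdm` are derived from the
instance data; no typed Theorem 3.11 premise is consumed (layer 1). Composition of p411395 + p411632 +
p413177 + p414039; nothing asserted. [claim: Mochizuki2012, status: disputed] -/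
theorem teamB_capstone_global_of_latticeRealisations
    (hlogvol : ∀ (j : T.Label) (vQ : T.VQ) (A : Set (S.L.Packet j vQ)),
      (S.D P.n).logvol j vQ A = (Λ j vQ).normalizedLogVolume (d j vQ) (e j vQ '' A))
    (hAdm : ∀ (j : T.Label) (vQ : T.VQ) (A : Set (S.L.Packet j vQ)),
      (S.D P.n).Adm j vQ A ↔
        0 < (Λ j vQ).haar (e j vQ '' A) ∧ (Λ j vQ).haar (e j vQ '' A) < ⊤)
    (hInd : ∀ Φ : S.L.PacketAut, (Φ ∈ S.L.Ind1Family ∨ Φ ∈ S.L.Ind2Family) →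
      ∀ (j : T.Label) (vQ : T.VQ),
      ∃ (χ : W j vQ ≃ₜ+ W j vQ) (Λ₀ : IntegralStructure (W j vQ)),
        χ '' (Λ₀ : Set (W j vQ)) = (Λ₀ : Set (W j vQ)) ∧ ∀ x, e j vQ (Φ j vQ x) = χ (e j vQ x))
    (hψ : ∀ (m : ℤ) (j : T.Label) (vQ : T.VQ), ∃ Λ₀ : IntegralStructure (W j vQ),
      ψ m j vQ '' (Λ₀ : Set (W j vQ)) = (Λ₀ : Set (W j vQ)))
    (hthetaEq : ∀ (m : ℤ) (i : Fin T.lstar) (vQ : T.VQ),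
      e (Setting.labelSucc i) vQ '' P.thetaRegion m (Setting.labelSucc i) vQ =
        ψ m (Setting.labelSucc i) vQ '' (e (Setting.labelSucc i) vQ '' R (Setting.labelSucc i) vQ))
    (hR : ∀ (i : Fin T.lstar) (vQ : T.VQ),
      0 < (Λ (Setting.labelSucc i) vQ).haar
          (e (Setting.labelSucc i) vQ '' R (Setting.labelSucc i) vQ) ∧
        (Λ (Setting.labelSucc i) vQ).haar
          (e (Setting.labelSucc i) vQ '' R (Setting.labelSucc i) vQ) < ⊤)
    (hmono : LogvolMono P)
    (h3adm : ∀ (i : Fin T.lstar) (vQ : T.VQ),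
      (S.D P.n).Adm (Setting.labelSucc i) vQ (P.thetaRegion3 (Setting.labelSucc i) vQ))
    (h3fin : ∀ i : Fin T.lstar, (Function.support fun vQ =>
      (S.D P.n).logvol (Setting.labelSucc i) vQ (P.thetaRegion3 (Setting.labelSucc i) vQ)).Finite)
    (hulne : ∀ (j : T.Label) (vQ : T.VQ), ∀ H ∈ (P.frame j vQ).Hul, H.Nonempty)
    (h3ne : ∀ (i : Fin T.lstar) (vQ : T.VQ),
      (P.thetaRegion3 (Setting.labelSucc i) vQ).Nonempty)
    (hfin : P.ThetaFinite)
    (hgvt : GlobalVolumeTransport P) : P.Statement := by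
  have hcrit := (S.D P.n).ind_adm_iff_and_logvolInvariant_of_latticeRealisations
    Λ d e hlogvol hAdm hInd
  have H : BridgeHyps P :=
    bridgeHyps_of_generators P hmono hcrit.1 hcrit.2 h3adm h3fin hulne h3ne hfin
  have hadm : ThetaRegionsAdm P :=
    thetaRegionsAdm_of_latticeRealisations P Λ e ψ R hAdm hψ hthetaEq hR
  exact hgvt.statement_of H hadm

/-- The uniform variant: the global comparison at ONE lattice position (`m₀ = 0` is the print's (xi-a)
gluing position) suffices. [claim: Mochizuki2012, status: disputed] -/
theorem teamB_capstone_global_at_of_latticeRealisations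
    (hlogvol : ∀ (j : T.Label) (vQ : T.VQ) (A : Set (S.L.Packet j vQ)),
      (S.D P.n).logvol j vQ A = (Λ j vQ).normalizedLogVolume (d j vQ) (e j vQ '' A))
    (hAdm : ∀ (j : T.Label) (vQ : T.VQ) (A : Set (S.L.Packet j vQ)),
      (S.D P.n).Adm j vQ A ↔
        0 < (Λ j vQ).haar (e j vQ '' A) ∧ (Λ j vQ).haar (e j vQ '' A) < ⊤)
    (hInd : ∀ Φ : S.L.PacketAut, (Φ ∈ S.L.Ind1Family ∨ Φ ∈ S.L.Ind2Family) →
      ∀ (j : T.Label) (vQ : T.VQ),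
      ∃ (χ : W j vQ ≃ₜ+ W j vQ) (Λ₀ : IntegralStructure (W j vQ)),
        χ '' (Λ₀ : Set (W j vQ)) = (Λ₀ : Set (W j vQ)) ∧ ∀ x, e j vQ (Φ j vQ x) = χ (e j vQ x))
    (hψ : ∀ (m : ℤ) (j : T.Label) (vQ : T.VQ), ∃ Λ₀ : IntegralStructure (W j vQ),
      ψ m j vQ '' (Λ₀ : Set (W j vQ)) = (Λ₀ : Set (W j vQ)))
    (hthetaEq : ∀ (m : ℤ) (i : Fin T.lstar) (vQ : T.VQ),
      e (Setting.labelSucc i) vQ '' P.thetaRegion m (Setting.labelSucc i) vQ =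
        ψ m (Setting.labelSucc i) vQ '' (e (Setting.labelSucc i) vQ '' R (Setting.labelSucc i) vQ))
    (hR : ∀ (i : Fin T.lstar) (vQ : T.VQ),
      0 < (Λ (Setting.labelSucc i) vQ).haar
          (e (Setting.labelSucc i) vQ '' R (Setting.labelSucc i) vQ) ∧
        (Λ (Setting.labelSucc i) vQ).haar
          (e (Setting.labelSucc i) vQ '' R (Setting.labelSucc i) vQ) < ⊤)
    (hmono : LogvolMono P)
    (h3adm : ∀ (i : Fin T.lstar) (vQ : T.VQ),
      (S.D P.n).Adm (Setting.labelSucc i) vQ (P.thetaRegion3 (Setting.labelSucc i) vQ))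
    (h3fin : ∀ i : Fin T.lstar, (Function.support fun vQ =>
      (S.D P.n).logvol (Setting.labelSucc i) vQ (P.thetaRegion3 (Setting.labelSucc i) vQ)).Finite)
    (hulne : ∀ (j : T.Label) (vQ : T.VQ), ∀ H ∈ (P.frame j vQ).Hul, H.Nonempty)
    (h3ne : ∀ (i : Fin T.lstar) (vQ : T.VQ),
      (P.thetaRegion3 (Setting.labelSucc i) vQ).Nonempty)
    (hfin : P.ThetaFinite)
    {m₀ : ℤ} (hgvt : GlobalVolumeTransportAt P m₀) : P.Statement :=
  teamB_capstone_global_of_latticeRealisations P Λ d e ψ R hlogvol hAdm hInd hψ hthetaEq hR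
    hmono h3adm h3fin hulne h3ne hfin (globalVolumeTransport_of_at hgvt)

end Cor312Vol

end IUTFork

end Summit.ABC

end
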